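import Summits.Ventures.CertifiedArithmetic.Expansions.CompressEmitDichotomy
import Summits.Ventures.CertifiedArithmetic.Expansions.CompressTopNoOvershoot
import Summits.Ventures.CertifiedArithmetic.Expansions.CompressTopPairAbsorbed

/-!
# COMPRESS twice: the top component survives each step of the first pass (new work, part 2 of 3)

New work of the certified-arithmetic venture (ENGINES group: shared numerical engines serving
client cells; rigour lives in the verifiers; every published number belongs to a client cell's
ledger, not to the engines group), part 2 of the series opened by
`Expansions/CompressTopStableTools.lean`: for `p ≥ 2` and ANY round-to-nearest, the largest
component of `COMPRESS(COMPRESS(e))` equals the largest component of `COMPRESS(e)`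
(`compress_compress_getLast`, part 3, `Expansions/CompressTopStable.lean`).

THE INVARIANT.  Follow the second (upward) traversal of the first pass; state `(rs, Q)` = the
components emitted so far (newest first) and the carry.  Besides Shewchuk's invariant `UpInv`,
the error invariant `|Σ rs| ≤ ulp(Q)/2 · (1 + ε + ⋯)` of `compress_top_error` and "the carry
absorbs the newest component, `fl(Q + r) = Q`" of `compress_top_absorbed`, the state satisfies
  `J(rs, Q)`:  `fl(Q + T) = Q` for the top component `T` of `COMPRESS(rs.reverse)`,
i.e. the carry absorbs what a SECOND pass makes of the components below it.  At the end
`J` is exactly the statement that the second pass returns the same top (read-out lemma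
`getLast?_compress_state` of part 1).  This file proves that `J` survives one step:
* EXACT STEP `Q ↦ g + Q` (`fl_add_eq_self_absorb_top`): `T` is a nonzero float faithful to
  `Σ rs`, absorbed by `Q`, so `|T| ≤ ulp(Q)/2` and the exact-step margin
  `fl_add_eq_self_after_absorb` of `CompressTopPairAbsorbed` applies to `T` in place of `r`.
* EMITTING STEP `(rs, Q) ↦ (q :: rs, Qn)` (`fl_add_eq_self_emit_top`), `T'` the top of
  `COMPRESS((q :: rs).reverse)`, a faithful rounding of `q + Σ rs` with the sign of `q`:
  - `Σ rs` against `q`: `|T'| ≤ |q|` and `Qn` absorbs `q`, hence `T'` (monotonicity);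
  - `Σ rs` with `q`, by the EMIT DICHOTOMY (`Expansions/CompressEmitDichotomy.lean`):
    SAME (`q = Q`, `Qn = g`): by `J` and the read-out lemma the second pass over `rs.reverse, Q`
    has top `Q` itself, so `T' = Q` and `fl(g + Q) = Qn`;
    REFLECTED at a TIE (`|Q| = 2^b`, `q = −Q`): the newest component and the old top `T` point
    from the power of two `Q` towards zero, so they are within a QUARTER ulp and `−Q = q`
    absorbs them as well (`fl_neg_add_eq_of_fl_add_eq_pow`) — again `T' = q`;
    REFLECTED, no tie (`2^b < |Q| < 2^(b+1)`, `|q| ≤ 2^b − ulp Q`): by the error invariant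
    `|q + Σ rs|` stays below `2^b` by more than the no-overshoot margin, so `|T'| < 2^b`
    (`abs_compress_getLast_lt_two_zpow`) and `Qn`, whose neighbour on that side is `g` at
    distance `2^(b+1)`, absorbs `T'`.

HONEST FRAMING: new work of this programme checked in Lean — a modest property of a textbook
procedure, not a published result and no open problem; [Shewchuk1997, §2.7 Thm 23 p. 331–333]
and [BoldoEtAl2023, §2] supply only the objects.
-/

namespace Summit.Ventures.CertifiedArithmetic.Expansions

open Literature.ComputerArithmetic.JeannerodRump2018
open Literature.ComputerArithmetic.BoldoJeannerodMelquiondMuller2023 hiding twoSum twoSum_fst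
open Literature.ComputerArithmetic.JoldesMullerPopescu2017 (ulp_le_of_abs_lt_two_zpow)
open Literature.ComputerArithmetic.GraillatMuller2025 (ulp_two_zpow)
open Literature.ComputerArithmetic.Shewchuk1997

variable {p : ℕ} {emin : ℤ} {fl : ℚ → ℚ}

/-! ### Small tools -/

/-- Powers of two at or above `2^emin` are floats (`p ≥ 1`). -/
private theorem two_zpow_isFloat (hp : 1 ≤ p) {k : ℤ} (hk : emin ≤ k) :
    IsFloat p emin ((2 : ℚ) ^ k) :=
  ⟨1, k, by rw [abs_one]; exact one_lt_pow₀ (by norm_num) (by omega), hk, by simp⟩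

/-- Sign chaining: `a ~ b` and `b ~ c` give `a ~ c`. -/
private theorem mul_pos_chain {a b c : ℚ} (h1 : 0 < a * b) (h2 : 0 < b * c) : 0 < a * c := by
  rcases mul_pos_iff.mp h1 with ⟨ha, hb⟩ | ⟨ha, hb⟩
  · rcases mul_pos_iff.mp h2 with ⟨-, hc⟩ | ⟨hb', -⟩
    · exact mul_pos ha hc
    · linarith
  · rcases mul_pos_iff.mp h2 with ⟨hb', -⟩ | ⟨-, hc⟩
    · linarith
    · exact mul_pos_of_neg_of_neg ha hc

/-- A sum is on the side of its dominant term. -/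
private theorem add_mul_pos_of_abs_lt {q s : ℚ} (h : |s| < |q|) : 0 < (q + s) * q := by
  rcases lt_trichotomy q 0 with hq | hq | hq
  · rw [abs_of_neg hq] at h
    exact mul_pos_of_neg_of_neg (by linarith [neg_abs_le s, le_abs_self s]) hq
  · rw [hq, abs_zero] at h; linarith [abs_nonneg s]
  · rw [abs_of_pos hq] at h
    exact mul_pos (by linarith [neg_abs_le s]) hq
/-! ### Two more rounding facts used with the dichotomy -/

/-- The ulp of a number in the binade `[2^b, 2^(b+1))` whose ulp exceeds `2^emin` is
`2^(b+1-p)`, and then `b ≥ emin + p`. [cite: BoldoEtAl2023, §2.1 Def. 2.4] -/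
theorem ulp_eq_of_two_zpow_le_of_lt {Q : ℚ} {b : ℤ} (hb : (2 : ℚ) ^ b ≤ |Q|)
    (hb' : |Q| < (2 : ℚ) ^ (b + 1)) (he : (2 : ℚ) ^ emin < ulp p emin Q) :
    ulp p emin Q = (2 : ℚ) ^ (b + 1 - p) ∧ emin + p ≤ b := by
  have hE : emin ≤ b + 1 - p := by
    by_contra h
    rw [not_le] at h
    have : |Q| < (2 : ℚ) ^ (emin + p - 1) :=
      hb'.trans_le (zpow_le_zpow_right₀ (by norm_num) (by omega))
    rw [ulp_eq_of_abs_lt this] at he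
    exact lt_irrefl _ he
  have hup : ulp p emin Q ≤ (2 : ℚ) ^ (b + 1 - p) := ulp_le_of_abs_lt_two_zpow hb' hE
  have hlow : (2 : ℚ) ^ (b + 1 - p) ≤ ulp p emin Q := by
    have := ulp_mono (p := p) (emin := emin)
      (show |(2 : ℚ) ^ b| ≤ |Q| by rwa [abs_of_pos (zpow_pos (by norm_num : (0 : ℚ) < 2) b)])
    rwa [ulp_two_zpow (by omega : emin ≤ b - p + 1), show b - (p : ℤ) + 1 = b + 1 - p by ring]
      at this
  have heq := le_antisymm hup hlow
  refine ⟨heq, ?_⟩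
  rw [heq] at he
  have := (zpow_lt_zpow_iff_right₀ (by norm_num : (1 : ℚ) < 2)).mp he
  omega

/-- TIE TRANSFER.  If the power of two `Q` (`|Q| = 2^b`, `b − p ≥ emin`) absorbs an addend `r`
pointing towards zero (`fl(Q + r) = Q`, whence `|r| ≤ ulp(Q)/4` by `abs_le_of_fl_add_eq_pow`),
then `−Q` absorbs it too: `fl(−Q + r) = −Q` (now `r` points away from zero, where the ulp is
twice as large). [cite: BoldoEtAl2023, §2.1 (spacing around a power of 2), §2.6 Property 2.7] -/
theorem fl_neg_add_eq_of_fl_add_eq_pow (hp1 : 1 ≤ p) (hfl : IsRoundNearest p emin fl)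
    {Q r : ℚ} {b : ℤ} (hQF : IsFloat p emin Q) (hQb : |Q| = (2 : ℚ) ^ b) (hb : emin ≤ b - p)
    (hr : fl (Q + r) = Q) (hrQ : Q * r < 0) : fl (-Q + r) = -Q := by
  have hr4 : |r| ≤ (2 : ℚ) ^ (b - p) / 2 := abs_le_of_fl_add_eq_pow hp1 hfl hQb hb hrQ hr
  have habs : |-Q + r| = |Q| + |r| := by
    rcases mul_neg_iff.mp hrQ with ⟨hQ0, hr0⟩ | ⟨hQ0, hr0⟩
    · rw [abs_of_neg (by linarith : -Q + r < 0), abs_of_pos hQ0, abs_of_neg hr0]; ring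
    · rw [abs_of_pos (by linarith : 0 < -Q + r), abs_of_neg hQ0, abs_of_pos hr0]
  apply fl_add_eq_self_of_le_abs hp1 hfl hQF.neg (e := b) (by omega)
  · rw [habs, hQb]; linarith [abs_nonneg r]
  · calc |r| ≤ (2 : ℚ) ^ (b - p) / 2 := hr4
      _ < (2 : ℚ) ^ (b - p + 1) / 2 := by
        rw [zpow_add_one₀ (by norm_num : (2 : ℚ) ≠ 0)]
        linarith [zpow_pos (by norm_num : (0 : ℚ) < 2) (b - p)]

/-! ### The invariant `J` survives the exact step -/

/-- EXACT STEP.  State `(rs, Q)` of the second traversal (`UpInv`), next component `g`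
(`|g| ≥ 2^(emin+p)`, `|Q| ≤ ulp g`, stair `|Q + Σ rs| < ulp g`) with `g + Q` a float; if `Q`
absorbs the top `T` of `COMPRESS(rs.reverse)` then so does `g + Q`.
[cite: Shewchuk1997, §2.7 Thm 23 p. 333 (proof)] [cite: BoldoEtAl2023, §2.6 Property 2.7] -/
theorem fl_add_eq_self_absorb_top (hp : 2 ≤ p) (hfl : IsRoundNearest p emin fl)
    {rs : List ℚ} {Q g : ℚ} (inv : UpInv p emin 1 rs Q) (hgbig : (2 : ℚ) ^ (emin + p) ≤ |g|)
    (hQg : |Q| ≤ ulp p emin g) (hstg : |Q + rs.sum| < ulp p emin g)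
    (hQnF : IsFloat p emin (g + Q))
    (hJ : ∀ T, (compress fl rs.reverse).getLast? = some T → fl (Q + T) = Q) :
    ∀ T, (compress fl rs.reverse).getLast? = some T → fl (g + Q + T) = g + Q := by
  have hp1 : 1 ≤ p := le_trans (by norm_num) hp
  intro T hT
  cases rs with
  | nil => simp [compress] at hT
  | cons r tl =>
    obtain ⟨hTF, -, herr, hT0, -⟩ := compress_rev_top hp hfl inv.floats inv.pw inv.ne hT
    have hfr := hJ T hT
    have hTQ : |T| ≤ ulp p emin Q / 2 := abs_le_half_ulp_of_fl_add_eq hp1 hfl hfr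
    have hlt : |(r :: tl).sum - T| < |T| := herr.trans_le (ulp_le_abs_of_isFloat hTF hT0)
    exact fl_add_eq_self_after_absorb hp hfl hgbig inv.hQ hQg hQnF hTF hT0 hTQ hfr
      (by rw [show Q + (T + ((r :: tl).sum - T)) = Q + (r :: tl).sum by ring]; exact hstg) hlt

/-! ### The invariant `J` survives the emitting step -/

/-- EMITTING STEP.  State `(rs, Q)` of the second traversal (`UpInv`, the error invariant
`|Σ rs| ≤ ulp(Q)/2 · (1 + ε + ⋯)`, `fl(Q + r) = Q` for the newest component, and `J(rs, Q)`),
next component `g` (`|g| ≥ 2^(emin+p)`, `|Q| ≤ ulp g`, sharp stair under `g`), inexact step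
`Qn = fl(g + Q)`, `q = g + Q − Qn ≠ 0`, new state `(q :: rs, Qn)` (`UpInv`).  Then
`J(q :: rs, Qn)`: `Qn` absorbs the top of `COMPRESS((q :: rs).reverse)`.
[cite: Shewchuk1997, §2.7 Thm 23 p. 333 (Lines 11–14)] [cite: BoldoEtAl2023, §2.6] -/
theorem fl_add_eq_self_emit_top (hp : 2 ≤ p) (hfl : IsRoundNearest p emin fl)
    {rs : List ℚ} {Q g Qn q : ℚ} (inv : UpInv p emin 1 rs Q)
    (hI : |rs.sum| ≤ ulp p emin Q / 2 * (Finset.range rs.length).sum (fun i => ((2 : ℚ) ^ p)⁻¹ ^ i))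
    (hg : IsFloat p emin g) (hgbig : (2 : ℚ) ^ (emin + p) ≤ |g|) (hQg : |Q| ≤ ulp p emin g)
    (hsharp : (∃ j : ℤ, emin + p ≤ j ∧ |g| = 2 ^ j) → g * (Q + rs.sum) < 0 →
      |Q + rs.sum| < ulp p emin g / 2)
    (h1 : fl (g + Q) = Qn) (h4 : Qn + q = g + Q) (hq0 : q ≠ 0)
    (inv' : UpInv p emin 1 (q :: rs) Qn)
    (htop : ∀ r ∈ rs.head?, fl (Q + r) = Q)
    (hJ : ∀ T, (compress fl rs.reverse).getLast? = some T → fl (Q + T) = Q) :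
    ∀ T', (compress fl (q :: rs).reverse).getLast? = some T' → fl (Qn + T') = Qn := by
  have hp1 : 1 ≤ p := le_trans (by norm_num) hp
  have h0 : fl 0 = 0 := fl_zero hfl
  have hQnF : IsFloat p emin Qn := by rw [← h1]; exact (hfl _).1
  have hqF : IsFloat p emin q := inv'.floats q (by simp)
  have hq_abs : fl (Qn + q) = Qn := by rw [h4, h1]
  intro T' hT'
  cases rs with
  | nil =>
    have : T' = q := by simpa [compress] using hT'.symm
    rw [this]; exact hq_abs
  | cons r tl =>
    have hrF : IsFloat p emin r := inv.floats r (by simp)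
    have hr0 : r ≠ 0 := inv.ne r (by simp)
    have hfr : fl (Q + r) = Q := htop r (by simp)
    have hb_old : ∀ r' ∈ (r :: tl).head?, fl r' = r' ∧ r' ≠ 0 ∧ fl (Q + r') = Q := by
      intro r' hr'
      have : r' = r := by simpa [eq_comm] using hr'
      rw [this]; exact ⟨fl_eq_self hfl hrF, hr0, hfr⟩
    have htail : |(r :: tl).sum| < |q| := abs_sum_tail_lt_head inv'.floats inv'.pw inv'.ne
    have htl : |tl.sum| < |r| := abs_sum_tail_lt_head inv.floats inv.pw inv.ne
    obtain ⟨hT'F, hT'faith, -, -, hT'sgn⟩ :=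
      compress_rev_top hp hfl inv'.floats inv'.pw inv'.ne hT'
    have hsumq : 0 < ((q :: r :: tl).sum) * q := by
      rw [List.sum_cons]; exact add_mul_pos_of_abs_lt htail
    have hT'q : 0 < T' * q := mul_pos_chain hT'sgn hsumq
    have hσ0 : (r :: tl).sum * q ≠ 0 := by
      refine mul_ne_zero ?_ hq0
      rw [List.sum_cons]; intro h
      have : |r| = |tl.sum| := by rw [show r = -tl.sum by linarith, abs_neg]
      linarith
    rcases lt_or_gt_of_ne hσ0 with hE1 | hE2
    · -- the emitted components point AGAINST `q`: `|T'| ≤ |q|`, monotonicity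
      have hle : |(q :: r :: tl).sum| ≤ |q| := by
        rw [List.sum_cons, abs_add_eq_sub_abs_of_mul_neg hE1 htail.le]
        linarith [abs_nonneg (r :: tl).sum]
      exact fl_add_eq_self_of_between hfl hQnF hq_abs hT'q.le
        (abs_le_abs_of_isFaithful hT'faith hqF hle)
    · -- the emitted components point WITH `q`: the emit dichotomy
      have hne : fl (g + Q) ≠ g + Q := by
        intro h; apply hq0; rw [h1] at h; linarith
      have hd := emit_dichotomy hp hfl hg hgbig inv.hQ hQg inv.sum_lt hsharp hne
      rw [h1, show g + Q - Qn = q by linarith] at hd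
      have hrq : 0 < r * q := by
        have h := add_mul_pos_of_abs_lt htl
        rw [← List.sum_cons, mul_comm] at h
        exact mul_pos_chain h hE2
      have he : (2 : ℚ) ^ emin < ulp p emin Q := two_zpow_emin_lt_ulp_of_upInv_cons inv
      rcases hd with hsame | ⟨b, hb1, hb2, hqQ, hsum, hadjx⟩
      · -- SAME: `q = Q`, and the second pass over `rs.reverse, Q` has top `Q` by `J`
        subst hsame
        have hQn : Qn = g := by linarith
        have hread := getLast?_compress_state h0 hb_old hJ
        rw [List.reverse_cons, hread] at hT'
        have : T' = q := by simpa using hT'.symm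
        rw [this]; exact hq_abs
      · rcases eq_or_lt_of_le hb1 with htie | hnontie
        · -- REFLECTED AT A TIE: `|Q| = 2^b`, `q = -Q` absorbs `r` and the old top as `Q` did
          have hQb : |Q| = (2 : ℚ) ^ b := htie.symm
          have hqQ' : q = -Q := by
            have habs : |q| = |Q| := by
              rw [hQb, zpow_add_one₀ (by norm_num : (2 : ℚ) ≠ 0)] at hsum
              rw [hQb]; linarith
            rcases abs_eq_abs.mp habs with h | h
            · exfalso; rw [h] at hqQ; linarith [mul_self_nonneg Q]
            · exact h
          subst hqQ'
          have hbp : emin ≤ b - p := by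
            have := (ulp_eq_of_two_zpow_le_of_lt hb1 hb2 he).2; omega
          have hrQ : Q * r < 0 := by linarith [hrq]
          have hfr' : fl (-Q + r) = -Q := fl_neg_add_eq_of_fl_add_eq_pow hp1 hfl inv.hQ hQb hbp hfr
            (by nlinarith [hrq])
          have hb_new : ∀ r' ∈ (r :: tl).head?, fl r' = r' ∧ r' ≠ 0 ∧ fl (-Q + r') = -Q := by
            intro r' hr'
            have : r' = r := by simpa [eq_comm] using hr'
            rw [this]; exact ⟨fl_eq_self hfl hrF, hr0, hfr'⟩
          have hJ' : ∀ T, (compress fl (r :: tl).reverse).getLast? = some T →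
              fl (-Q + T) = -Q := by
            intro T hT
            obtain ⟨-, -, -, -, hTsgn⟩ := compress_rev_top hp hfl inv.floats inv.pw inv.ne hT
            have hTq : 0 < T * -Q := mul_pos_chain hTsgn hE2
            exact fl_neg_add_eq_of_fl_add_eq_pow hp1 hfl inv.hQ hQb hbp (hJ T hT) (by nlinarith)
          have hread := getLast?_compress_state h0 hb_new hJ'
          rw [List.reverse_cons, hread] at hT'
          have : T' = -Q := by simpa using hT'.symm
          rw [this]; exact hq_abs
        · -- REFLECTED, NO TIE: the no-overshoot theorem keeps `|T'| < 2^b`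
          obtain ⟨hulpQ, hbe⟩ := ulp_eq_of_two_zpow_le_of_lt hb1 hb2 he
          have hQge : (2 : ℚ) ^ b + (2 : ℚ) ^ (b + 1 - p) ≤ |Q| := by
            have h := abs_add_ulp_le_abs inv.hQ (two_zpow_isFloat hp1 (by omega : emin ≤ b))
              (show |(2 : ℚ) ^ b| < |Q| by rwa [abs_of_pos (zpow_pos (by norm_num) _)])
            rwa [abs_of_pos (zpow_pos (by norm_num) _), ulp_two_zpow (by omega : emin ≤ b - p + 1),
              show b - (p : ℤ) + 1 = b + 1 - p by ring] at h
          have hqle : |q| ≤ (2 : ℚ) ^ b - (2 : ℚ) ^ (b + 1 - p) := by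
            rw [zpow_add_one₀ (by norm_num : (2 : ℚ) ≠ 0)] at hsum; linarith
          have hσle : |(r :: tl).sum| ≤ (2 : ℚ) ^ (b + 1 - p) / 2 *
              (Finset.range (r :: tl).length).sum (fun i => ((2 : ℚ) ^ p)⁻¹ ^ i) := by
            rw [← hulpQ]; exact hI
          have hmargin := abs_add_lt_pow2_margin hp hqle hσle
          have hexp : IsExpansion 1 (q :: r :: tl).reverse := by
            unfold IsExpansion; exact List.pairwise_reverse.mpr inv'.pw
          have hlt : |T'| < (2 : ℚ) ^ b :=
            abs_compress_getLast_lt_two_zpow hp hfl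
              (fun x hx => inv'.floats x (List.mem_reverse.mp hx)) hexp hbe
              (by rw [List.sum_reverse, List.sum_cons]; exact hmargin) T' hT'
          exact hadjx T' hT'q hlt

end Summit.Ventures.CertifiedArithmetic.Expansions
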